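import Literature.Analysis.FunctionSpaces.PoissonPointProcessUniqueness
import Literature.Probability.Percolation.PositiveAssociation
import HarnessLib

/-!
# Harris–FKG for the counts of a Poisson point process over finitely many disjoint sets

(topic Analysis/FunctionSpaces; no new definitions, no new named facts.)

Let `P` be (the law of) a Poisson point process on `E` with intensity `ν`
(`IsPoissonPointProcess ν P`, Kingman 1993, §2.1) and let `t₁, …, tₙ` be pairwise disjoint
measurable sets of finite intensity. The **count vector** `N⃗ = (N(t₁), …, N(tₙ)) : κ → ℕ∞` has the
product law `⨂ₖ Poisson(ν tₖ)` (Kingman's axioms (i)–(ii); the tree's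
`IsPoissonPointProcess.map_count_pi_eq`), i.e. its coordinates are independent random variables with
values in the linearly ordered space `ℕ∞`. By **Harris' lemma** for product measures (Harris 1960,
Lemma 4.1; Grimmett 1999, Thm. (2.4); the tree's `isPositivelyAssociated_infinitePi` /
`infinitePi_harris_dependsOn`) the law of `N⃗` is therefore **positively associated**: increasing
events (upper sets of `κ → ℕ∞` for the coordinatewise order) are positively correlated,
`P(N⃗ ∈ A) P(N⃗ ∈ B) ≤ P(N⃗ ∈ A ∩ B)`, and increasing functions of `N⃗` are positively correlated,
`E[F(N⃗)] E[G(N⃗)] ≤ E[F(N⃗) G(N⃗)]`.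

This is the finite-partition layer of the **Harris–FKG inequality for Poisson processes**
(Last–Penrose 2017, Thm. 20.4: `E[f(η) g(η)] ≥ E[f(η)] E[g(η)]` for increasing `f, g ∈ L²(P_η)`;
first proved by Roy 1991 "by reduction to the discrete version for Bernoulli random fields",
Last–Penrose, notes to Ch. 20), which is its limit along finer and finer partitions; it is the
form in which FKG for Poisson–Voronoi percolation is used cell by cell (Benjamini–Schramm 1998, §7).

## Main results (all proved)

* `PointConfig.measurable_counts` — the count-vector map `c ↦ (N_c(tₖ))ₖ` is measurable.
* `IsPoissonPointProcess.map_count_eq_infinitePi` — the law of the count vector as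
  `Measure.infinitePi` of the Poisson marginals (the `Measure.pi` form is `map_count_pi_eq`).
* `IsPoissonPointProcess.isPositivelyAssociated_map_counts` — **Harris–FKG for Poisson counts**:
  the law of `N⃗` is positively associated (`Literature.Probability.Percolation.IsPositivelyAssociated`).
* `IsPoissonPointProcess.harris_counts`, `harris_counts_real`, `harris_counts_lowerSet` — the
  unfolded inequalities `P(N⃗ ∈ A) P(N⃗ ∈ B) ≤ P(N⃗ ∈ A ∩ B)` for increasing (resp. decreasing)
  events `A, B ⊆ (κ → ℕ∞)`, in `ℝ≥0∞` and in `ℝ`.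
* `IsPoissonPointProcess.integral_mul_integral_le_integral_mul_counts` — the covariance form
  `E[F(N⃗)] E[G(N⃗)] ≤ E[F(N⃗) G(N⃗)]` for increasing `F, G : (κ → ℕ∞) → ℝ` (automatically bounded,
  between their values at `⊥ = 0` and `⊤`, and measurable, `κ → ℕ∞` being countable).

Every subset of `κ → ℕ∞` (`κ` finite) is measurable, so no measurability hypotheses on the events
or functions of the count vector appear.

## Not here

The full Harris–FKG inequality for increasing `L²` functionals of the configuration
(Last–Penrose 2017, Thm. 20.4; Roy 1991), i.e. the passage to the limit along partitions / the
covariance identity of Last–Penrose Thm. 20.2, is NOT vendored here.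

## References

* G. Last, M. Penrose, *Lectures on the Poisson Process*, Cambridge University Press (2017),
  §20.3, Thm. 20.4, p. 217, and the notes to Ch. 20. [cite: LastPenrose2017, Thm 20.4]
* J. F. C. Kingman, *Poisson Processes*, Oxford University Press (1993), §2.1. [cite: Kingman1993, §2.1]
* T. E. Harris, A lower bound for the critical probability in a certain percolation process,
  *Proc. Cambridge Philos. Soc.* 56 (1960), 13–20, Lemma 4.1. [cite: Harris1960, Lemma 4.1]
* G. Grimmett, *Percolation*, 2nd ed., Springer (1999), §2.2, Thm. (2.4).
  [cite: GrimmettPercolation1999, §2.2 Thm. (2.4)]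
* I. Benjamini, O. Schramm, Conformal invariance of Voronoi percolation,
  *Comm. Math. Phys.* 197 (1998), 75–107, §7.
-/

open MeasureTheory ProbabilityTheory Set
open scoped ENNReal NNReal

namespace Literature.Analysis.FunctionSpaces

open Literature.Probability.Percolation

variable {E : Type*} [TopologicalSpace E] [MeasurableSpace E]

namespace PointConfig

/-- The count-vector map `c ↦ (N_c(tₖ))ₖ` of a family of measurable sets `tₖ` is measurable
(each coordinate `c ↦ N_c(tₖ)` is, Kingman 1993, §2.1). [folklore] -/
theorem measurable_counts {κ : Type*} {t : κ → Set E} (ht : ∀ k, MeasurableSet (t k)) :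
    Measurable fun (c : PointConfig E) k => c.count (t k) :=
  measurable_pi_lambda _ fun k => PointConfig.measurable_count (ht k)

end PointConfig

namespace IsPoissonPointProcess

variable {ν : Measure E} {P : Measure (PointConfig E)} {κ : Type*} [Fintype κ] {t : κ → Set E}

/-- **Law of the count vector as an (`infinitePi`) product of Poisson laws**: for finitely many
pairwise disjoint measurable sets `tₖ` of finite intensity, the count vector
`c ↦ (N_c(tₖ))ₖ` of a Poisson point process has law `Measure.infinitePi (k ↦ Poisson(ν tₖ))` on
`κ → ℕ∞` (Kingman 1993, §2.1, axioms (i)–(ii); the `Measure.pi` form is `map_count_pi_eq`, and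
`Measure.infinitePi = Measure.pi` over a finite index type). [cite: Kingman1993, §2.1, p. 12] -/
theorem map_count_eq_infinitePi (h : IsPoissonPointProcess ν P) (ht : ∀ k, MeasurableSet (t k))
    (hd : Pairwise (Function.onFun Disjoint t)) (hfin : ∀ k, ν (t k) ≠ ∞) :
    P.map (fun c k => c.count (t k)) =
      Measure.infinitePi fun k => (poissonMeasure (ν (t k)).toNNReal).map ((↑) : ℕ → ℕ∞) := by
  rw [Measure.infinitePi_eq_pi]
  exact h.map_count_pi_eq ht hd hfin

/-- **Harris–FKG for Poisson counts.** Under a Poisson point process, the law of the vector of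
counts `(N(tₖ))ₖ : κ → ℕ∞` of finitely many pairwise disjoint measurable sets of finite intensity
is positively associated (coordinatewise order): increasing events of the count vector are
positively correlated. Proof: the coordinates are independent Poisson variables (Kingman 1993,
§2.1), and a product of probability measures on linearly ordered spaces is positively associated by
Harris' lemma (Harris 1960, Lemma 4.1; Grimmett 1999, Thm. (2.4);
`isPositivelyAssociated_infinitePi`). This is the finite-partition layer of the Harris–FKG
inequality for Poisson processes (Last–Penrose 2017, Thm. 20.4; Roy 1991).
[cite: LastPenrose2017, Thm 20.4] -/
theorem isPositivelyAssociated_map_counts (h : IsPoissonPointProcess ν P)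
    (ht : ∀ k, MeasurableSet (t k)) (hd : Pairwise (Function.onFun Disjoint t))
    (hfin : ∀ k, ν (t k) ≠ ∞) :
    IsPositivelyAssociated (P.map fun c k => c.count (t k)) := by
  rw [h.map_count_eq_infinitePi ht hd hfin]
  exact isPositivelyAssociated_infinitePi _

/-- **Harris–FKG for Poisson counts, increasing events** (`ℝ≥0∞` form): for upper sets `A, B` of
count vectors `κ → ℕ∞` (coordinatewise order; every such set is measurable, `κ` being finite),
`P(N⃗ ∈ A) · P(N⃗ ∈ B) ≤ P(N⃗ ∈ A ∩ B)` (Last–Penrose 2017, Thm. 20.4, for functionals of the counts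
of a finite partition; Harris 1960, Lemma 4.1). [cite: LastPenrose2017, Thm 20.4] -/
theorem harris_counts (h : IsPoissonPointProcess ν P) (ht : ∀ k, MeasurableSet (t k))
    (hd : Pairwise (Function.onFun Disjoint t)) (hfin : ∀ k, ν (t k) ≠ ∞) {A B : Set (κ → ℕ∞)}
    (hA : IsUpperSet A) (hB : IsUpperSet B) :
    P ((fun c k => c.count (t k)) ⁻¹' A) * P ((fun c k => c.count (t k)) ⁻¹' B) ≤
      P ((fun c k => c.count (t k)) ⁻¹' (A ∩ B)) := by
  have hf := PointConfig.measurable_counts ht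
  have hAm : MeasurableSet A := A.to_countable.measurableSet
  have hBm : MeasurableSet B := B.to_countable.measurableSet
  have := h.isPositivelyAssociated_map_counts ht hd hfin A B hA hB hAm hBm
  rwa [Measure.map_apply hf hAm, Measure.map_apply hf hBm,
    Measure.map_apply hf (hAm.inter hBm)] at this

/-- **Harris–FKG for Poisson counts, increasing events** (real form): for upper sets `A, B` of
count vectors, `P(N⃗ ∈ A) · P(N⃗ ∈ B) ≤ P(N⃗ ∈ A ∩ B)` with real-valued probabilities
(Last–Penrose 2017, Thm. 20.4; Harris 1960, Lemma 4.1). [cite: LastPenrose2017, Thm 20.4] -/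
theorem harris_counts_real (h : IsPoissonPointProcess ν P) (ht : ∀ k, MeasurableSet (t k))
    (hd : Pairwise (Function.onFun Disjoint t)) (hfin : ∀ k, ν (t k) ≠ ∞) {A B : Set (κ → ℕ∞)}
    (hA : IsUpperSet A) (hB : IsUpperSet B) :
    P.real ((fun c k => c.count (t k)) ⁻¹' A) * P.real ((fun c k => c.count (t k)) ⁻¹' B) ≤
      P.real ((fun c k => c.count (t k)) ⁻¹' (A ∩ B)) := by
  haveI := h.isProbabilityMeasure
  have h' := h.harris_counts ht hd hfin hA hB
  rw [measureReal_def, measureReal_def, measureReal_def, ← ENNReal.toReal_mul]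
  exact ENNReal.toReal_mono (measure_ne_top P _) h'

/-- **Harris–FKG for Poisson counts, decreasing events**: for lower sets `A, B` of count vectors
`κ → ℕ∞`, `P(N⃗ ∈ A) · P(N⃗ ∈ B) ≤ P(N⃗ ∈ A ∩ B)` as well (pass to the increasing complements;
Grimmett 1999, remark after Thm. (2.4); Last–Penrose 2017, Thm. 20.4 with `f, g` decreasing).
[cite: LastPenrose2017, Thm 20.4] -/
theorem harris_counts_lowerSet (h : IsPoissonPointProcess ν P) (ht : ∀ k, MeasurableSet (t k))
    (hd : Pairwise (Function.onFun Disjoint t)) (hfin : ∀ k, ν (t k) ≠ ∞) {A B : Set (κ → ℕ∞)}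
    (hA : IsLowerSet A) (hB : IsLowerSet B) :
    P ((fun c k => c.count (t k)) ⁻¹' A) * P ((fun c k => c.count (t k)) ⁻¹' B) ≤
      P ((fun c k => c.count (t k)) ⁻¹' (A ∩ B)) := by
  haveI := h.isProbabilityMeasure
  have hf := PointConfig.measurable_counts ht
  haveI : IsProbabilityMeasure (P.map fun c k => c.count (t k)) :=
    Measure.isProbabilityMeasure_map hf.aemeasurable
  have hAm : MeasurableSet A := A.to_countable.measurableSet
  have hBm : MeasurableSet B := B.to_countable.measurableSet
  have := (h.isPositivelyAssociated_map_counts ht hd hfin).lowerSet hA hB hAm hBm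
  rwa [Measure.map_apply hf hAm, Measure.map_apply hf hBm,
    Measure.map_apply hf (hAm.inter hBm)] at this

/-- **Harris–FKG for Poisson counts, covariance form**: for increasing functions
`F, G : (κ → ℕ∞) → ℝ` of the count vector of finitely many pairwise disjoint measurable sets of
finite intensity, `E[F(N⃗)] · E[G(N⃗)] ≤ E[F(N⃗) G(N⃗)]` (Last–Penrose 2017, Thm. 20.4, display
(20.20), for functionals of the counts of a finite partition; Harris 1960, Lemma 4.1, via the
tree's `infinitePi_harris_dependsOn`). No boundedness or measurability hypotheses: an increasing
`F` lies between `F ⊥` and `F ⊤`, and every function on the countable space `κ → ℕ∞` is measurable.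
[cite: LastPenrose2017, Thm 20.4] -/
theorem integral_mul_integral_le_integral_mul_counts (h : IsPoissonPointProcess ν P)
    (ht : ∀ k, MeasurableSet (t k)) (hd : Pairwise (Function.onFun Disjoint t))
    (hfin : ∀ k, ν (t k) ≠ ∞) {F G : (κ → ℕ∞) → ℝ} (hF : Monotone F) (hG : Monotone G) :
    (∫ c, F (fun k => c.count (t k)) ∂P) * (∫ c, G (fun k => c.count (t k)) ∂P) ≤
      ∫ c, F (fun k => c.count (t k)) * G (fun k => c.count (t k)) ∂P := by
  classical
  have hf := PointConfig.measurable_counts ht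
  -- increasing functions on `κ → ℕ∞` are bounded
  have hb : ∀ {H : (κ → ℕ∞) → ℝ}, Monotone H → ∀ v, ‖H v‖ ≤ max |H ⊥| |H ⊤| := fun hH v =>
    (Real.norm_eq_abs _).le.trans (abs_le_max_abs_abs (hH bot_le) (hH le_top))
  -- transport the three integrals to the law of the count vector
  have e : ∀ H : (κ → ℕ∞) → ℝ, ∫ c, H (fun k => c.count (t k)) ∂P =
      ∫ v, H v ∂Measure.infinitePi fun k =>
        (poissonMeasure (ν (t k)).toNNReal).map ((↑) : ℕ → ℕ∞) := by
    intro H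
    rw [← h.map_count_eq_infinitePi ht hd hfin,
      integral_map hf.aemeasurable (measurable_of_countable H).aestronglyMeasurable]
  rw [e F, e G, e fun v => F v * G v]
  exact infinitePi_harris_dependsOn _ Finset.univ hF hG (measurable_of_countable F)
    (measurable_of_countable G) (by rw [Finset.coe_univ]; exact dependsOn_univ F)
    (by rw [Finset.coe_univ]; exact dependsOn_univ G)
    (fun v => (hb hF v).trans (le_max_left _ (max |G ⊥| |G ⊤|)))
    (fun v => (hb hG v).trans (le_max_right (max |F ⊥| |F ⊤|) _))

end IsPoissonPointProcess

end Literature.Analysis.FunctionSpaces
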